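import Summits.ValiantsHypothesis.ValiantsHypothesis.Theorems.KPlusLogSqLawTropicalBToeplitzDoublingPrelims
import Summits.ValiantsHypothesis.ValiantsHypothesis.Theorems.KPlusLogSqLawTropicalBToeplitzAdmissible

/-!
# Route `KPlusLogSqLaw`, crux `TropicalB` — Toeplitz sector: BIPARTITE permutations of `Fin (n + n)` and the doubled instance (doubling law, part 1)

HONEST FRAMING.  Helper toward the registered stubs `stub_tropThin` / `stub_tropFat` (crux `…Theses.KPlusLogSqLaw.TropicalB`, item
`stmt-ValiantsHypothesis-19771`; cell `pub-symmetroid`, seat `val-sym-trop-p4` (g22), 2026-08-29).  Third ingredient group of this seat's BIPARTITE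
DOUBLING LAW (memo HOME/val-sym-trop-p4/g22/DOUBLING-g22.md §1, §5(b); the law itself is the sibling `…ToeplitzDoubling`): bipartite permutations of
`Fin (n + n)` (lower half up by `π`, upper half down by `ρ`): `sum_bip_split` (any displacement sum splits over the halves), `sq_sum_bip`
(`X' = 2n³ + X π + X ρ`), `mkBip_apply_castAdd/natAdd` + `eq_mkBip_of_apply` (the explicit permutation `finSumFin ∘ swap ∘ (π ⊕ ρ) ∘ finSumFin⁻¹` and its
characterisation), `exists_halves_of_bipartite` (every `τ` with `p < n ↔ n ≤ τ p` has halves), `bipartite_of_halves`; the DOUBLED INSTANCE with intercepts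
`g + C|δ|`, `g δ = α₁(δ − n)` (`δ > 0`), `α₂(δ + n) − μ(δ + n)²` (`δ < 0`): `weight_halves` (**`W'(mkBip π ρ) = θ(2n³ + Xπ + Xρ) + Y₁π + Y₂ρ − μXρ + 2Cn²`**),
`weight_split`, and the crude bounds `sq_displacement_le`, `abs_sum_sq_displacement_le`, `abs_sum_le_of_bound`, `abs_g_le`, `abs_sum_alpha_le`,
`abs_le_sum_abs_Icc`.  Nothing here bounds `Φ_Toep`; nothing bears on `TropicalB` for general designs, `KPlusLogSqLaw`, `MatrixDescartes` or `VP ≠ VNP`.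
References: folklore; this seat's memo.
-/

set_option linter.dupNamespace false
set_option autoImplicit false

namespace Summit.ValiantsHypothesis.ValiantsHypothesis.Theorems.KPlusLogSqLaw.Toeplitz

open scoped BigOperators
open Finset

section Doubling

variable {n : ℕ}

/-! ### Bipartite permutations of `Fin (n + n)`: the weight splits over the two halves -/

/-- **Weight split.**  If `σ'` sends the lower half up by `π` and the upper half down by `ρ`
(`σ' (castAdd a) = natAdd (π a)`, `σ' (natAdd i) = castAdd (ρ i)`), then for every `f`:
`Σ_p f (σ' p − p) = Σ_a f (n + (π a − a)) + Σ_i f (−n + (ρ i − i))`. [folklore] -/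
theorem sum_bip_split (f : ℤ → ℤ) (π ρ : Equiv.Perm (Fin n)) (σ' : Equiv.Perm (Fin (n + n)))
    (hl : ∀ a : Fin n, σ' (Fin.castAdd n a) = Fin.natAdd n (π a))
    (hr : ∀ i : Fin n, σ' (Fin.natAdd n i) = Fin.castAdd n (ρ i)) :
    ∑ p : Fin (n + n), f (((σ' p : Fin (n + n)) : ℤ) - (p : ℤ)) =
      ∑ a : Fin n, f ((n : ℤ) + (((π a : Fin n) : ℤ) - (a : ℤ))) + ∑ i : Fin n, f (-(n : ℤ) + (((ρ i : Fin n) : ℤ) - (i : ℤ))) := by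
  rw [Fin.sum_univ_add]
  congr 1
  · refine sum_congr rfl fun a _ => ?_
    rw [hl a]; simp only [Fin.val_natAdd, Fin.val_castAdd]; push_cast; ring_nf
  · refine sum_congr rfl fun i _ => ?_
    rw [hr i]; simp only [Fin.val_natAdd, Fin.val_castAdd]; push_cast; ring_nf

/-- squared displacement of a bipartite permutation: `X'(σ') = 2n³ + X(π) + X(ρ)`. [folklore] -/
theorem sq_sum_bip (π ρ : Equiv.Perm (Fin n)) (σ' : Equiv.Perm (Fin (n + n)))
    (hl : ∀ a : Fin n, σ' (Fin.castAdd n a) = Fin.natAdd n (π a))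
    (hr : ∀ i : Fin n, σ' (Fin.natAdd n i) = Fin.castAdd n (ρ i)) :
    ∑ p : Fin (n + n), (((σ' p : Fin (n + n)) : ℤ) - (p : ℤ)) ^ 2 =
      2 * (n : ℤ) ^ 3 + ∑ a : Fin n, (((π a : Fin n) : ℤ) - (a : ℤ)) ^ 2 + ∑ i : Fin n, (((ρ i : Fin n) : ℤ) - (i : ℤ)) ^ 2 := by
  rw [sum_bip_split (fun δ => δ ^ 2) π ρ σ' hl hr]
  have hπ : ∑ a : Fin n, (((π a : Fin n) : ℤ) - (a : ℤ)) = 0 := by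
    rw [sum_sub_distrib, Equiv.sum_comp π (fun a : Fin n => (a : ℤ))]; ring
  have hρ : ∑ i : Fin n, (((ρ i : Fin n) : ℤ) - (i : ℤ)) = 0 := by
    rw [sum_sub_distrib, Equiv.sum_comp ρ (fun a : Fin n => (a : ℤ))]; ring
  have e1 : ∑ a : Fin n, ((n : ℤ) + (((π a : Fin n) : ℤ) - (a : ℤ))) ^ 2 =
      ∑ _a : Fin n, (n : ℤ) ^ 2 + 2 * (n : ℤ) * ∑ a : Fin n, (((π a : Fin n) : ℤ) - (a : ℤ)) +
        ∑ a : Fin n, (((π a : Fin n) : ℤ) - (a : ℤ)) ^ 2 := by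
    rw [mul_sum, ← sum_add_distrib, ← sum_add_distrib]; exact sum_congr rfl fun a _ => by ring
  have e2 : ∑ i : Fin n, (-(n : ℤ) + (((ρ i : Fin n) : ℤ) - (i : ℤ))) ^ 2 =
      ∑ _i : Fin n, (n : ℤ) ^ 2 - 2 * (n : ℤ) * ∑ i : Fin n, (((ρ i : Fin n) : ℤ) - (i : ℤ)) +
        ∑ i : Fin n, (((ρ i : Fin n) : ℤ) - (i : ℤ)) ^ 2 := by
    rw [mul_sum, ← sum_sub_distrib, ← sum_add_distrib]; exact sum_congr rfl fun a _ => by ring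
  rw [e1, e2, hπ, hρ]
  simp only [sum_const, card_univ, Fintype.card_fin]
  ring

/-- **The bipartite permutation with halves `π`, `ρ`**: `mkBip π ρ = finSumFin ∘ swap ∘ (π ⊕ ρ) ∘ finSumFin⁻¹`; its values on the two halves. -/
theorem mkBip_apply_castAdd (π ρ : Equiv.Perm (Fin n)) (a : Fin n) :
    (finSumFinEquiv.symm.trans ((Equiv.sumCongr π ρ).trans ((Equiv.sumComm (Fin n) (Fin n)).trans finSumFinEquiv)))
      (Fin.castAdd n a) = Fin.natAdd n (π a) := by
  rw [Equiv.trans_apply, Equiv.trans_apply, Equiv.trans_apply, finSumFinEquiv_symm_apply_castAdd, Equiv.sumCongr_apply,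
    Sum.map_inl, Equiv.sumComm_apply, Sum.swap_inl, finSumFinEquiv_apply_right]

/-- values of `mkBip π ρ` on the upper half. -/
theorem mkBip_apply_natAdd (π ρ : Equiv.Perm (Fin n)) (i : Fin n) :
    (finSumFinEquiv.symm.trans ((Equiv.sumCongr π ρ).trans ((Equiv.sumComm (Fin n) (Fin n)).trans finSumFinEquiv)))
      (Fin.natAdd n i) = Fin.castAdd n (ρ i) := by
  rw [Equiv.trans_apply, Equiv.trans_apply, Equiv.trans_apply, finSumFinEquiv_symm_apply_natAdd, Equiv.sumCongr_apply,
    Sum.map_inr, Equiv.sumComm_apply, Sum.swap_inr, finSumFinEquiv_apply_left]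

/-- A permutation with bipartite VALUES (lower half up by `π`, upper half down by `ρ`) IS `mkBip π ρ`. -/
theorem eq_mkBip_of_apply (π ρ : Equiv.Perm (Fin n)) (σ' : Equiv.Perm (Fin (n + n)))
    (hl : ∀ a : Fin n, σ' (Fin.castAdd n a) = Fin.natAdd n (π a))
    (hr : ∀ i : Fin n, σ' (Fin.natAdd n i) = Fin.castAdd n (ρ i)) :
    σ' = finSumFinEquiv.symm.trans ((Equiv.sumCongr π ρ).trans ((Equiv.sumComm (Fin n) (Fin n)).trans finSumFinEquiv)) := by
  ext p
  have hp' : finSumFinEquiv (finSumFinEquiv.symm p) = p := finSumFinEquiv.apply_symm_apply p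
  rcases hp : finSumFinEquiv.symm p with a | i
  · rw [hp, finSumFinEquiv_apply_left] at hp'
    rw [← hp', hl, mkBip_apply_castAdd]
  · rw [hp, finSumFinEquiv_apply_right] at hp'
    rw [← hp', hr, mkBip_apply_natAdd]

/-- **Bipartite decomposition.**  If every lower position goes up and every upper position goes down (`p < n ↔ n ≤ σ' p`), then
`σ'` has halves: there are `π ρ : Perm (Fin n)` with `σ' (castAdd a) = natAdd (π a)` and `σ' (natAdd i) = castAdd (ρ i)`. [folklore] -/
theorem exists_halves_of_bipartite (σ' : Equiv.Perm (Fin (n + n)))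
    (hbip : ∀ p : Fin (n + n), (p : ℕ) < n ↔ n ≤ ((σ' p : Fin (n + n)) : ℕ)) :
    ∃ π ρ : Equiv.Perm (Fin n), (∀ a : Fin n, σ' (Fin.castAdd n a) = Fin.natAdd n (π a)) ∧
      (∀ i : Fin n, σ' (Fin.natAdd n i) = Fin.castAdd n (ρ i)) := by
  -- the two half-maps
  have hup : ∀ a : Fin n, n ≤ ((σ' (Fin.castAdd n a) : Fin (n + n)) : ℕ) := fun a => (hbip _).mp (by simp)
  have hdown : ∀ i : Fin n, ((σ' (Fin.natAdd n i) : Fin (n + n)) : ℕ) < n := by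
    intro i
    by_contra h; push Not at h
    have := (hbip (Fin.natAdd n i)).mpr h
    simp at this
  let f : Fin n → Fin n := fun a => ⟨((σ' (Fin.castAdd n a) : Fin (n + n)) : ℕ) - n, by
    have := (σ' (Fin.castAdd n a)).isLt; have := hup a; omega⟩
  let g : Fin n → Fin n := fun i => ⟨((σ' (Fin.natAdd n i) : Fin (n + n)) : ℕ), hdown i⟩
  have hf : Function.Injective f := by
    intro a a' h
    have hv : ((σ' (Fin.castAdd n a) : Fin (n + n)) : ℕ) = ((σ' (Fin.castAdd n a') : Fin (n + n)) : ℕ) := by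
      have := congrArg Fin.val h; simp only [f] at this; have := hup a; have := hup a'; omega
    have := σ'.injective (Fin.ext hv)
    simpa using this
  have hg : Function.Injective g := by
    intro i i' h
    have hv : ((σ' (Fin.natAdd n i) : Fin (n + n)) : ℕ) = ((σ' (Fin.natAdd n i') : Fin (n + n)) : ℕ) := by
      have := congrArg Fin.val h; simpa [g] using this
    have := σ'.injective (Fin.ext hv)
    simpa using this
  refine ⟨Equiv.ofBijective f (Finite.injective_iff_bijective.mp hf), Equiv.ofBijective g (Finite.injective_iff_bijective.mp hg),
    fun a => ?_, fun i => ?_⟩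
  · apply Fin.ext
    simp only [Equiv.ofBijective_apply, Fin.val_natAdd, f]
    have := hup a; omega
  · apply Fin.ext
    simp only [Equiv.ofBijective_apply, Fin.val_castAdd, g]

/-! ### Crude bounds -/

/-- every displacement of a permutation of `Fin m` has absolute value `< m`, hence square `≤ m²`. -/
theorem sq_displacement_le {m : ℕ} (σ : Equiv.Perm (Fin m)) (p : Fin m) :
    (((σ p : Fin m) : ℤ) - (p : ℤ)) ^ 2 ≤ (m : ℤ) ^ 2 := by
  have h1 := (σ p).isLt; have h2 := p.isLt
  have hab : |((σ p : Fin m) : ℤ) - (p : ℤ)| ≤ (m : ℤ) := by rw [abs_le]; constructor <;> omega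
  calc (((σ p : Fin m) : ℤ) - (p : ℤ)) ^ 2 = |((σ p : Fin m) : ℤ) - (p : ℤ)| ^ 2 := (sq_abs _).symm
    _ ≤ (m : ℤ) ^ 2 := pow_le_pow_left₀ (abs_nonneg _) hab 2

/-- `|Σ_p θ (σ p − p)²| ≤ |θ|·m·m²`. -/
theorem abs_sum_sq_displacement_le {m : ℕ} (σ : Equiv.Perm (Fin m)) (θ : ℤ) :
    |∑ p : Fin m, θ * (((σ p : Fin m) : ℤ) - (p : ℤ)) ^ 2| ≤ |θ| * ((m : ℤ) * (m : ℤ) ^ 2) := by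
  rw [← mul_sum, abs_mul]
  refine mul_le_mul_of_nonneg_left ?_ (abs_nonneg _)
  rw [abs_of_nonneg (sum_nonneg fun p _ => sq_nonneg _)]
  calc ∑ p : Fin m, (((σ p : Fin m) : ℤ) - (p : ℤ)) ^ 2 ≤ ∑ _p : Fin m, (m : ℤ) ^ 2 := sum_le_sum fun p _ => sq_displacement_le σ p
    _ = (m : ℤ) * (m : ℤ) ^ 2 := by simp

/-- a function bounded by `G` on `(−m, m)` sums to at most `m·G` in absolute value over the displacements of a permutation of `Fin m`. -/
theorem abs_sum_le_of_bound {m : ℕ} (σ : Equiv.Perm (Fin m)) (g : ℤ → ℤ) (G : ℤ)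
    (hg : ∀ δ : ℤ, -(m : ℤ) < δ → δ < m → |g δ| ≤ G) :
    |∑ p : Fin m, g (((σ p : Fin m) : ℤ) - (p : ℤ))| ≤ (m : ℤ) * G := by
  calc |∑ p : Fin m, g (((σ p : Fin m) : ℤ) - (p : ℤ))| ≤ ∑ p : Fin m, |g (((σ p : Fin m) : ℤ) - (p : ℤ))| := abs_sum_le_sum_abs _ _
    _ ≤ ∑ _p : Fin m, G := sum_le_sum fun p _ => hg _ (by have := (σ p).isLt; have := p.isLt; omega)
        (by have := (σ p).isLt; have := p.isLt; omega)
    _ = (m : ℤ) * G := by simp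

/-- a single value of `|α|` is below the sum of `|α|` over an integer interval containing the argument. -/
theorem abs_le_sum_abs_Icc (α : ℤ → ℤ) {L δ : ℤ} (h1 : -L ≤ δ) (h2 : δ ≤ L) :
    |α δ| ≤ ∑ d ∈ Icc (-L) L, |α d| :=
  single_le_sum (f := fun d => |α d|) (fun _ _ => abs_nonneg _) (mem_Icc.mpr ⟨h1, h2⟩)

/-- bipartiteness of a permutation with halves. -/
theorem bipartite_of_halves (π ρ : Equiv.Perm (Fin n)) (σ' : Equiv.Perm (Fin (n + n)))
    (hl : ∀ a : Fin n, σ' (Fin.castAdd n a) = Fin.natAdd n (π a))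
    (hr : ∀ i : Fin n, σ' (Fin.natAdd n i) = Fin.castAdd n (ρ i)) :
    ∀ p : Fin (n + n), (p : ℕ) < n ↔ n ≤ ((σ' p : Fin (n + n)) : ℕ) := by
  intro p
  have hp' : finSumFinEquiv (finSumFinEquiv.symm p) = p := finSumFinEquiv.apply_symm_apply p
  rcases hp : finSumFinEquiv.symm p with a | i
  · rw [hp, finSumFinEquiv_apply_left] at hp'
    rw [← hp', hl]; simp
  · rw [hp, finSumFinEquiv_apply_right] at hp'
    rw [← hp', hr]; simp

/-- **Weight of a bipartite permutation in the doubled instance.**  With intercepts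
`α' δ = g δ + C|δ|`, `g δ = α₁(δ − n)` (`δ > 0`), `α₂(δ + n) − μ (δ + n)²` (`δ < 0`), `0` (`δ = 0`), the weight of `mkBip π ρ` at slope `θ` is
`θ(2n³ + X π + X ρ) + Y₁ π + Y₂ ρ − μ X ρ + 2Cn²`. -/
theorem weight_halves (α₁ α₂ : ℤ → ℤ) (μ C θ : ℤ) (π ρ : Equiv.Perm (Fin n)) (σ' : Equiv.Perm (Fin (n + n)))
    (hl : ∀ a : Fin n, σ' (Fin.castAdd n a) = Fin.natAdd n (π a))
    (hr : ∀ i : Fin n, σ' (Fin.natAdd n i) = Fin.castAdd n (ρ i)) :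
    ∑ p : Fin (n + n), (θ * (fun δ : ℤ => δ ^ 2) (((σ' p : Fin (n + n)) : ℤ) - (p : ℤ)) +
        (fun δ : ℤ => (if 0 < δ then α₁ (δ - n) else if δ < 0 then α₂ (δ + n) - μ * (δ + n) ^ 2 else 0) + C * |δ|)
          (((σ' p : Fin (n + n)) : ℤ) - (p : ℤ))) =
      θ * (2 * (n : ℤ) ^ 3 + ∑ a : Fin n, (((π a : Fin n) : ℤ) - (a : ℤ)) ^ 2 + ∑ i : Fin n, (((ρ i : Fin n) : ℤ) - (i : ℤ)) ^ 2)
        + ∑ a : Fin n, α₁ (((π a : Fin n) : ℤ) - (a : ℤ)) + ∑ i : Fin n, α₂ (((ρ i : Fin n) : ℤ) - (i : ℤ))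
        - μ * ∑ i : Fin n, (((ρ i : Fin n) : ℤ) - (i : ℤ)) ^ 2 + C * (2 * (n : ℤ) ^ 2) := by
  have hX := sq_sum_bip π ρ σ' hl hr
  have hF := footrule_eq_of_bipartite σ' (bipartite_of_halves π ρ σ' hl hr)
  have hg := sum_bip_split (fun δ : ℤ => if 0 < δ then α₁ (δ - n) else if δ < 0 then α₂ (δ + n) - μ * (δ + n) ^ 2 else 0) π ρ σ' hl hr
  -- simplify the two halves of `hg`
  have hgl : ∀ a : Fin n, (fun δ : ℤ => if 0 < δ then α₁ (δ - n) else if δ < 0 then α₂ (δ + n) - μ * (δ + n) ^ 2 else 0)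
      ((n : ℤ) + (((π a : Fin n) : ℤ) - (a : ℤ))) = α₁ (((π a : Fin n) : ℤ) - (a : ℤ)) := by
    intro a
    have h1 := (π a).isLt; have h2 := a.isLt
    have hpos : (0 : ℤ) < (n : ℤ) + (((π a : Fin n) : ℤ) - (a : ℤ)) := by omega
    simp only [if_pos hpos]; congr 1; ring
  have hgr : ∀ i : Fin n, (fun δ : ℤ => if 0 < δ then α₁ (δ - n) else if δ < 0 then α₂ (δ + n) - μ * (δ + n) ^ 2 else 0)
      (-(n : ℤ) + (((ρ i : Fin n) : ℤ) - (i : ℤ))) = α₂ (((ρ i : Fin n) : ℤ) - (i : ℤ)) - μ * (((ρ i : Fin n) : ℤ) - (i : ℤ)) ^ 2 := by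
    intro i
    have h1 := (ρ i).isLt; have h2 := i.isLt
    have hneg : -(n : ℤ) + (((ρ i : Fin n) : ℤ) - (i : ℤ)) < 0 := by omega
    have hnpos : ¬ (0 : ℤ) < -(n : ℤ) + (((ρ i : Fin n) : ℤ) - (i : ℤ)) := by omega
    simp only [if_neg hnpos, if_pos hneg]; congr 1 <;> [congr 1; congr 1] <;> ring
  rw [sum_congr rfl fun a _ => hgl a, sum_congr rfl fun i _ => hgr i] at hg
  -- assemble
  simp only [sum_add_distrib, ← mul_sum]
  rw [hX, hg, hF, sum_sub_distrib, ← mul_sum]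
  ring

/-- **Weight of an arbitrary permutation in the doubled instance**, split into its three parts. -/
theorem weight_split (α₁ α₂ : ℤ → ℤ) (μ C θ : ℤ) (σ' : Equiv.Perm (Fin (n + n))) :
    ∑ p : Fin (n + n), (θ * (fun δ : ℤ => δ ^ 2) (((σ' p : Fin (n + n)) : ℤ) - (p : ℤ)) +
        (fun δ : ℤ => (if 0 < δ then α₁ (δ - n) else if δ < 0 then α₂ (δ + n) - μ * (δ + n) ^ 2 else 0) + C * |δ|)
          (((σ' p : Fin (n + n)) : ℤ) - (p : ℤ))) =
      ∑ p : Fin (n + n), θ * (((σ' p : Fin (n + n)) : ℤ) - (p : ℤ)) ^ 2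
        + ∑ p : Fin (n + n), (fun δ : ℤ => if 0 < δ then α₁ (δ - n) else if δ < 0 then α₂ (δ + n) - μ * (δ + n) ^ 2 else 0)
            (((σ' p : Fin (n + n)) : ℤ) - (p : ℤ))
        + C * ∑ p : Fin (n + n), |((σ' p : Fin (n + n)) : ℤ) - (p : ℤ)| := by
  simp only [sum_add_distrib, ← mul_sum]
  ring

/-- the intercept perturbation `g` is bounded by `A + μ n²` on `(−2n, 2n)` when `A` dominates `|α₁|`, `|α₂|` on `[−n, n]` and `μ ≥ 0`. -/
theorem abs_g_le (α₁ α₂ : ℤ → ℤ) (μ : ℤ) (hμ : 0 ≤ μ) (δ : ℤ) (h1 : -((n : ℤ) + n) < δ) (h2 : δ < (n : ℤ) + n) :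
    |(fun δ : ℤ => if 0 < δ then α₁ (δ - n) else if δ < 0 then α₂ (δ + n) - μ * (δ + n) ^ 2 else 0) δ| ≤
      (∑ d ∈ Icc (-(n : ℤ)) n, (|α₁ d| + |α₂ d|)) + μ * (n : ℤ) ^ 2 := by
  have hA : ∀ d : ℤ, -(n : ℤ) ≤ d → d ≤ n → |α₁ d| + |α₂ d| ≤ ∑ d ∈ Icc (-(n : ℤ)) n, (|α₁ d| + |α₂ d|) :=
    fun d hd1 hd2 => single_le_sum (f := fun d => |α₁ d| + |α₂ d|) (fun _ _ => by positivity) (mem_Icc.mpr ⟨hd1, hd2⟩)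
  have hμn : 0 ≤ μ * (n : ℤ) ^ 2 := by positivity
  simp only
  by_cases hp : 0 < δ
  · rw [if_pos hp]
    have := hA (δ - n) (by omega) (by omega)
    have := abs_nonneg (α₂ (δ - n)); omega
  · rw [if_neg hp]
    by_cases hn : δ < 0
    · rw [if_pos hn]
      have := hA (δ + n) (by omega) (by omega)
      have h3 : |α₂ (δ + n) - μ * (δ + n) ^ 2| ≤ |α₂ (δ + n)| + μ * (δ + n) ^ 2 := by
        have := abs_sub (α₂ (δ + n)) (μ * (δ + n) ^ 2)
        rwa [abs_of_nonneg (by positivity : (0 : ℤ) ≤ μ * (δ + n) ^ 2)] at this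
      have h4 : μ * (δ + n) ^ 2 ≤ μ * (n : ℤ) ^ 2 := by
        apply mul_le_mul_of_nonneg_left _ hμ
        have : |δ + n| ≤ n := by rw [abs_le]; constructor <;> omega
        calc (δ + (n : ℤ)) ^ 2 = |δ + n| ^ 2 := (sq_abs _).symm
          _ ≤ (n : ℤ) ^ 2 := pow_le_pow_left₀ (abs_nonneg _) this 2
      have := abs_nonneg (α₁ (δ + n)); omega
    · rw [if_neg hn]; simp only [abs_zero]
      have : 0 ≤ ∑ d ∈ Icc (-(n : ℤ)) n, (|α₁ d| + |α₂ d|) := sum_nonneg fun _ _ => by positivity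
      omega

/-- a sum of `n` values of `α` over displacements of a permutation of `Fin n` is bounded by `n·A`. -/
theorem abs_sum_alpha_le (α : ℤ → ℤ) (A : ℤ) (hA : ∀ d : ℤ, -(n : ℤ) ≤ d → d ≤ n → |α d| ≤ A) (π : Equiv.Perm (Fin n)) :
    |∑ a : Fin n, α (((π a : Fin n) : ℤ) - (a : ℤ))| ≤ (n : ℤ) * A :=
  abs_sum_le_of_bound π α A fun d h1 h2 => hA d (by omega) (by omega)


end Doubling

end Summit.ValiantsHypothesis.ValiantsHypothesis.Theorems.KPlusLogSqLaw.Toeplitz
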